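import Mathlib
import HarnessLib
import Summits.HubbardSuperconductivity.HubbardSuperconductivity.Theorems.KLProgrammeKLRegimeSplitTwoLegScaleZeroSizes

/-!
# Route `KLProgramme` — gen-5 ENGINE child 19918, stub `stub_twoLeg_scale0`: (E3a) tier-1 sizes of the scale-`0` piece with the
# COUNTERTERM VERTEX SEPARATED — `S₀ᴷ − K = symInterp(g) + [symInterp(K∘p) − K]`, `g := klLocSelfEnergyRe … K 0 − K∘p`

Cell `gate-hubbard-kl`, seat p1b (g7).  Why (finding, STATUS 2026-08-27T04:27:57Z): the tree closer `twoLegPieceFn_eval_zero_tier1_size_le`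
(p490369) bounds `‖∇ᵏ(evalM S₀ − evalM K)‖` by `2Msₖ + A` (triangle inequality; `Msₖ` = moments of the FULL scale-`0` two-leg kernel, which
contains the counterterm vertex `K` and the O(U) Hartree tadpole; `A ∋ 2Gfr₀|U| + Gfr₂·c/log 4`), so its fit into `twoLegBar G Q U j 0 =
(Sⱼ + S'ⱼ|U|)·U²` (`j = 1, 2`) can never be met.  Here the reading function is split ADDITIVELY (value-level linearity of `symInterp`,
`eval_symInterp_sub`):

  `F := evalM S₀ − evalM K = F_g + F_a`, `F_g := evalM (symInterp L g)`, `g k⃗ := klLocSelfEnergyRe … K 0 k⃗ − K(p_k⃗)` (the scale-`0`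
  localised self-energy BEYOND the frame vertex), `F_a := evalM (symInterp L (K∘p)) − evalM K` (the interpolation / aliasing error of the
  frame, `0` when `deg K < L/2`),

and the sizes are taken as HYPOTHESES on the two summands separately, orders `k ≤ 2` only (`mₖ ≥ ‖DᵏF_g‖`, `aₖ ≥ ‖DᵏF_a‖`); orders `3, 4`
(needed only to run k3c3-p3's composite tower) are INTRINSIC (`coeffNorm`, no export).  Suppliers: `mₖ` (k ≥ 1) from the OFF-ZERO coefficient
moments of `g` (`norm_iteratedFDeriv_evalM_symInterp_le_offZero_moments`, `…SymInterpPureMoments` — the constant mode, i.e. the tadpole and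
every spatially local term, drops), hence from the off-diagonal position moments of the K-separated two-leg kernel; `aₖ` from an
interpolation-error lemma (owed; see the seat's memo SCALE0-TWOLEG-EXPORTS.md).

* **`twoLegPieceFn_eval_zero_tier1_size_le_sep`**: for `j ≤ 2`,
  `‖Dʲ onM ℓ₀(K.eval)(q)‖ ≤ [j=0]·M₀ + (j!)²(2·j!·X·200ʲ)·Gⱼ·(4 + max 1 ((j−1)!/(8/5)))ʲ`, `Mₖ := mₖ + aₖ`, `G₀ = 2M₀`,
  `G₁ = (2π+1)·M₁·klCurveD1`, `G₂ = G₁ + M₂·klCurveD1² + M₁·klCurveD2` — the tree statement with `2Msₖ + A ↦ mₖ + aₖ`.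

Proof only (the tree proof, re-keyed); nothing about the model is asserted.  References: BGM 2006 (2.36), §2.4 [cite: BenfattoGiulianiMastropietro2006].
-/

noncomputable section

namespace Summit.HubbardSuperconductivity.HubbardSuperconductivity.Theorems.KLRegimeSplit

set_option linter.dupNamespace false -- summit = problem name (single-conjunct summit), D-0017

open Real Finset
open Literature.MathematicalPhysics.QuantumLattice Literature.MathematicalPhysics.QuantumLattice.BandSectorCounting
open Literature.Probability.LatticeModels
open Summit.HubbardSuperconductivity.HubbardSuperconductivity.Theorems.DispersionFlow
open Summit.HubbardSuperconductivity.HubbardSuperconductivity.Theorems.PerturbedFermiCurve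
open Summit.HubbardSuperconductivity.HubbardSuperconductivity.Theorems.KLProgrammeLegKernels
open Summit.HubbardSuperconductivity.HubbardSuperconductivity.Theorems.TwoLegFourier

variable {L M : ℕ} [NeZero L] [NeZero M]

/-- **(E3a) tier 1 of the scale-`0` piece, COUNTERTERM VERTEX SEPARATED** (see the module docstring): sizes `mₖ` of
`evalM (symInterp L g)`, `g = klLocSelfEnergyRe … K 0 − K∘p`, and `aₖ` of the frame's interpolation error `evalM (symInterp L (K∘p)) − evalM K`,
orders `k ≤ 2`. -/
theorem twoLegPieceFn_eval_zero_tier1_size_le_sep {R : RenConsts} (hR : ∀ j, 0 ≤ R.Gfr j) {c : ℝ} (hc : 0 < c) (hcle : c ≤ klCurveC3 R)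
    {U : ℝ} (hU : 0 < U) (hUle : U ≤ klCurveU0 R) {β : ℝ} (hβmin : klBetaMin ≤ β) (hβc : β ≤ Real.exp (c / U ^ 2))
    {μ : ℝ} (hμ : μ ∈ klWindowC) {K : TrigPolyC4v} (hK : FrameOK R U (nScales β) μ K) {m a : ℕ → ℝ}
    (hm : ∀ k ≤ 2, ∀ p : Momentum, ‖iteratedFDeriv ℝ k
      (evalM (symInterp L (fun q => klLocSelfEnergyRe L M β U μ K 0 q - K.eval (latticeMomentum L q)))) p‖ ≤ m k)
    (ha : ∀ k ≤ 2, ∀ p : Momentum, ‖iteratedFDeriv ℝ k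
      (fun p : Momentum => evalM (symInterp L (fun q => K.eval (latticeMomentum L q))) p - evalM K p) p‖ ≤ a k)
    {j : ℕ} (hj : j ≤ 2) {X : ℝ} (hX : ∀ l ≤ j, ∀ x : ℝ, ‖iteratedFDeriv ℝ l salmhoferCutoff x‖ ≤ X) (q : Momentum) :
    ‖iteratedFDeriv ℝ j (onM (klTwoLegPieceFn L M β U μ K.eval 0)) q‖ ≤
      (if j = 0 then m 0 + a 0 else 0) +
        (j.factorial : ℝ) ^ 2 * (2 * j.factorial * X * 200 ^ j) *
          (if j = 0 then 2 * (m 0 + a 0) else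
            (2 * π + 1) * ((m 1 + a 1) * klCurveD1) +
              (if j = 2 then (m 2 + a 2) * klCurveD1 ^ 2 + (m 1 + a 1) * klCurveD2 else 0)) *
          (4 + max 1 (((j - 1).factorial : ℝ) / (8 / 5))) ^ j := by
  have ha' : (-4 : ℝ) < -1.1 := by norm_num
  have hab : (-1.1 : ℝ) ≤ -0.1 := by norm_num
  have hb : (-0.1 : ℝ) < 0 := by norm_num
  set B := bandBounds ha' hab hb with hBdef
  obtain ⟨hAf, hA20, hADt, -, ⟨hlo, hhi⟩, hA3f, hA4f⟩ := frame_sizes_of_frameOK_explicit hR hc hcle hU hUle hβmin hβc hμ hK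
  have hβ : 0 < β := lt_of_lt_of_le (by unfold klBetaMin; norm_num) hβmin
  -- the reading function `F = S₀ − K = F_g + F_a` and the profile `δ₀ = F ∘ γ`
  set S₀ := symInterp L (klLocSelfEnergyRe L M β U μ K 0) with hS₀
  set F : Momentum → ℝ := fun p => evalM S₀ p - evalM K p with hF
  set Fg : Momentum → ℝ := evalM (symInterp L (fun q => klLocSelfEnergyRe L M β U μ K 0 q - K.eval (latticeMomentum L q))) with hFg
  set Fa : Momentum → ℝ := fun p => evalM (symInterp L (fun q => K.eval (latticeMomentum L q))) p - evalM K p with hFa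
  have hsplit : F = fun p => Fg p + Fa p := by
    funext p
    simp only [hF, hFg, hFa, hS₀, evalM_apply]
    rw [show (klLocSelfEnergyRe L M β U μ K 0) = fun q => (klLocSelfEnergyRe L M β U μ K 0 q - K.eval (latticeMomentum L q)) +
      K.eval (latticeMomentum L q) from funext fun q => by ring]
    rw [eval_symInterp_add]
    ring
  set γ : ℝ → Momentum := fun θ => (WithLp.toLp 2 (klFermiPoint μ K θ) : Momentum) with hγdef
  set δ : ℝ → ℝ := fun θ => klLocalPart L M β U μ K 0 θ - K.eval (klFermiPoint μ K θ) with hδ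
  have hδF : δ = F ∘ γ := klLocalPart_zero_sub_frame_eq_comp β U μ K
  have hFc : ContDiff ℝ 4 F := (contDiff_evalM S₀).sub (contDiff_evalM K)
  have hFgc : ∀ {k : WithTop ℕ∞}, ContDiff ℝ k Fg := fun {k} => contDiff_evalM _
  have hFac : ∀ {k : WithTop ℕ∞}, ContDiff ℝ k Fa := fun {k} => (contDiff_evalM _).sub (contDiff_evalM K)
  -- momentum-side sizes `Mf k` of `F`: orders ≤ 2 from the two summands, orders 3, 4 intrinsic (used only to invoke the tower)
  set Mf : ℕ → ℝ := fun k => if k ≤ 2 then m k + a k else S₀.coeffNorm k + K.coeffNorm k with hMf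
  have hMk : ∀ k ≤ 4, ∀ p : Momentum, ‖iteratedFDeriv ℝ k F p‖ ≤ Mf k := by
    intro k hk p
    by_cases hk2 : k ≤ 2
    · have h2 : Mf k = m k + a k := by simp [hMf, hk2]
      rw [h2, hsplit]
      rw [show (fun p => Fg p + Fa p) = Fg + Fa from rfl,
        iteratedFDeriv_add_apply (hFgc.contDiffAt.of_le le_top) (hFac.contDiffAt.of_le le_top)]
      exact (norm_add_le _ _).trans (add_le_add (hm k hk2 p) (ha k hk2 p))
    · have h2 : Mf k = S₀.coeffNorm k + K.coeffNorm k := by simp [hMf, hk2]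
      rw [h2, hF, fun_iteratedFDeriv_sub_apply ((contDiff_evalM S₀).contDiffAt.of_le le_top)
        ((contDiff_evalM K).contDiffAt.of_le le_top)]
      exact (norm_sub_le _ _).trans (add_le_add (norm_iteratedFDeriv_evalM_le_coeffNorm S₀ k p)
        (norm_iteratedFDeriv_evalM_le_coeffNorm K k p))
  have hM0 : Mf 0 = m 0 + a 0 := by simp [hMf]
  have hM1 : Mf 1 = m 1 + a 1 := by simp [hMf]
  have hM2 : Mf 2 = m 2 + a 2 := by simp [hMf]
  -- the profile: value, first and second derivative
  have hval : ∀ θ, |δ θ| ≤ m 0 + a 0 := fun θ => by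
    rw [hδF, Function.comp_apply, ← Real.norm_eq_abs, ← norm_iteratedFDeriv_zero (𝕜 := ℝ), ← hM0]
    exact hMk 0 (by norm_num) _
  have hstruct := fun θ => abs_iteratedDeriv_comp_fermiPointLp_le_struct hR hc hcle hU hUle hβmin hβc hμ hK hA3f hA4f hFc θ
    (m := Mf) (fun k _ hk4 => hMk k hk4 _)
  have hδc : ContDiff ℝ 4 δ := by
    rw [hδF]; exact hFc.comp (fermiPointLp_sizes_explicit hR hc hcle hU hUle hβmin hβc hμ hK hA3f hA4f 0).1
  have hdiff : Differentiable ℝ δ := hδc.differentiable (by norm_num)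
  have hper : Function.Periodic δ (2 * π) := fun θ => by
    simp only [hδ, klLocalPart_periodic β U μ K 0 θ, frameOnCurve_periodic μ K θ]
  have h1 : ∀ θ, |deriv δ θ| ≤ (m 1 + a 1) * klCurveD1 := fun θ => by
    rw [← iteratedDeriv_one, hδF, ← hM1]; exact (hstruct θ).1
  have h2 : ∀ θ, |iteratedDeriv 2 δ θ| ≤ (m 2 + a 2) * klCurveD1 ^ 2 + (m 1 + a 1) * klCurveD2 := fun θ => by
    rw [hδF, ← hM1, ← hM2]; exact (hstruct θ).2.1
  have hmean : |klAngularMean δ| ≤ m 0 + a 0 := abs_klAngularMean_le' hval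
  have hosc : ∀ t, |δ t - klAngularMean δ| ≤ 2 * π * ((m 1 + a 1) * klCurveD1) := fun t =>
    abs_sub_klAngularMean_le_of_deriv hdiff hper h1 t
  have hB1 : 0 ≤ (m 1 + a 1) * klCurveD1 := (abs_nonneg _).trans (h1 0)
  have hB2 : 0 ≤ (m 2 + a 2) * klCurveD1 ^ 2 + (m 1 + a 1) * klCurveD2 := (abs_nonneg _).trans (h2 0)
  -- the centred profile's `iteratedFDeriv` sizes, per order
  have hcd : ∀ i ≤ 2, ∀ t, 1 ≤ i → iteratedFDeriv ℝ i (fun t => δ t - klAngularMean δ) t = iteratedFDeriv ℝ i δ t := by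
    intro i hi t hi1
    rw [fun_iteratedFDeriv_sub_apply (hδc.contDiffAt.of_le (by exact_mod_cast hi.trans (by norm_num))) contDiffAt_const,
      iteratedFDeriv_const_of_ne (by omega), Pi.zero_apply, sub_zero]
  have hG0 : ∀ t, ‖iteratedFDeriv ℝ 0 (fun t => δ t - klAngularMean δ) t‖ ≤ 2 * (m 0 + a 0) := fun t => by
    rw [norm_iteratedFDeriv_zero, Real.norm_eq_abs]
    have := abs_sub (δ t) (klAngularMean δ); have := hval t; linarith
  have hG0' : ∀ t, ‖iteratedFDeriv ℝ 0 (fun t => δ t - klAngularMean δ) t‖ ≤ (2 * π + 1) * ((m 1 + a 1) * klCurveD1) := fun t => by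
    rw [norm_iteratedFDeriv_zero, Real.norm_eq_abs]; have := hosc t; nlinarith
  have hG1 : ∀ t, ‖iteratedFDeriv ℝ 1 (fun t => δ t - klAngularMean δ) t‖ ≤ (2 * π + 1) * ((m 1 + a 1) * klCurveD1) := fun t => by
    rw [hcd 1 (by norm_num) t le_rfl, norm_iteratedFDeriv_eq_norm_iteratedDeriv, iteratedDeriv_one, Real.norm_eq_abs]
    have := h1 t; nlinarith [Real.pi_pos]
  have hG2 : ∀ t, ‖iteratedFDeriv ℝ 2 (fun t => δ t - klAngularMean δ) t‖ ≤
      (m 2 + a 2) * klCurveD1 ^ 2 + (m 1 + a 1) * klCurveD2 := fun t => by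
    rw [hcd 2 le_rfl t (by norm_num), norm_iteratedFDeriv_eq_norm_iteratedDeriv, Real.norm_eq_abs]; exact h2 t
  -- the piece as a G-extension and the symbol-side calculus, per order
  have h0c : Continuous (klLocalPart L M β U μ K 0) := (contDiff_klLocalPart B hAf hADt hlo hhi L M β U 0 (m := 0)).continuous
  have hKc : Continuous fun θ => K.eval (klFermiPoint μ K θ) := (contDiff_eval_klFermiPoint B hAf hADt hlo hhi K (m := 0)).continuous
  have hP := klTwoLegPieceFn_eval_zero (L := L) (M := M) β U μ K h0c hKc
  have key : ∀ {G : ℝ}, (∀ i ≤ j, ∀ t : ℝ, ‖iteratedFDeriv ℝ i (fun t => δ t - klAngularMean δ) t‖ ≤ G) →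
      ‖iteratedFDeriv ℝ j (onM (klTwoLegPieceFn L M β U μ K.eval 0)) q‖ ≤
        (if j = 0 then m 0 + a 0 else 0) +
          (j.factorial : ℝ) ^ 2 * (2 * j.factorial * X * 200 ^ j) * G * (4 + max 1 (((j - 1).factorial : ℝ) / (8 / 5))) ^ j := by
    intro G hG
    have hmain := norm_iteratedFDeriv_onM_piece_le hP (N := 4) hδc hper (j := j) (by exact_mod_cast hj.trans (by norm_num)) hμ hG hX q
    refine hmain.trans (add_le_add ?_ le_rfl)
    split_ifs
    · exact hmean
    · exact le_rfl
  rcases Nat.lt_or_ge j 1 with hj0 | hj1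
  · have hj0' : j = 0 := by omega
    subst hj0'
    simp only [if_true] at key ⊢
    exact key fun i hi t => by
      have hi0 : i = 0 := by omega
      subst hi0; exact hG0 t
  · have hjne : j ≠ 0 := by omega
    rcases Nat.lt_or_ge j 2 with hj1' | hj2
    · have hj1'' : j = 1 := by omega
      subst hj1''
      simp only [if_neg one_ne_zero, show (1 : ℕ) ≠ 2 by norm_num, if_false, add_zero] at key ⊢
      exact key fun i hi t => by
        rcases Nat.eq_zero_or_pos i with rfl | hipos
        · exact hG0' t
        · have hi1 : i = 1 := by omega
          subst hi1; exact hG1 t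
    · have hj2' : j = 2 := by omega
      subst hj2'
      simp only [show (2 : ℕ) ≠ 0 by norm_num, if_false, if_true] at key ⊢
      exact key fun i hi t => by
        rcases Nat.eq_zero_or_pos i with rfl | hipos
        · exact (hG0' t).trans (le_add_of_nonneg_right hB2)
        · rcases (show i = 1 ∨ i = 2 by omega) with rfl | rfl
          · exact (hG1 t).trans (le_add_of_nonneg_right hB2)
          · exact (hG2 t).trans (le_add_of_nonneg_left (by positivity))

end Summit.HubbardSuperconductivity.HubbardSuperconductivity.Theorems.KLRegimeSplit

end
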